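import Summits.QuantumFields.BalabanUV.T4Continuum.E3Cert.ZL2d4DeficitAllU.Data
/-! E3 certificate package `ZL2d4DeficitAllU` — module `S9` ((4,2,1) = one L = 2 block in d = 4, SU(2) ≅ S³ links in the quaternion model,
ALL-U per-link DEFICIT law γ(x) = 1013∕1024 − (241∕1024)·Σ_tΠ_t(1−u₀); emitter `bal_e3_lean_emit.py` output for `block-L2d4-su2-deficit-allU-dyadic.json`,
lane `run/shared/lean/ttrl/balaban-calc/e3/lean-draft/tree/zL2d4DeficitAllU/S9.lean`; TREE COPY by the substrate cell (E3 hand of record, typer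
rulings (μ3)∕(μ3′)∕(μ6), journal l.19196 ∕ l.19672): import prefix substituted and one-line docstrings added BY SCRIPT, no literal touched).  Meaning of
the certificate: see `Data.lean` ∕ `Main.lean` of this package and the checker `E3Cert/E3PolyCertZ*.lean`.  HONEST: certified computation on ONE
small block — NOT Prop. (1.8), NOT an input of any NE row today, NOT infinite volume ∕ mass gap ∕ Clay. -/
set_option maxRecDepth 200000
set_option maxHeartbeats 0
namespace E3Z
/-- E3 certificate `zL2d4DeficitAllU` component: `zL2d4DeficitAllU_blk7` (lane output, transcribed verbatim; see the module docstring). -/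
theorem zL2d4DeficitAllU_blk7 : (GramCert.blockCert zL2d4DeficitAllU.nx zL2d4DeficitAllU.basis (zL2d4DeficitAllU.blocks.getD 7 (⟨[], 0, [], 0, []⟩, 0)).1).check = true := by
  decide +kernel
/-- E3 certificate `zL2d4DeficitAllU` component: `zL2d4DeficitAllU_blk8` (lane output, transcribed verbatim; see the module docstring). -/
theorem zL2d4DeficitAllU_blk8 : (GramCert.blockCert zL2d4DeficitAllU.nx zL2d4DeficitAllU.basis (zL2d4DeficitAllU.blocks.getD 8 (⟨[], 0, [], 0, []⟩, 0)).1).check = true := by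
  decide +kernel
/-- E3 certificate `zL2d4DeficitAllU` component: `zL2d4DeficitAllU_blk9` (lane output, transcribed verbatim; see the module docstring). -/
theorem zL2d4DeficitAllU_blk9 : (GramCert.blockCert zL2d4DeficitAllU.nx zL2d4DeficitAllU.basis (zL2d4DeficitAllU.blocks.getD 9 (⟨[], 0, [], 0, []⟩, 0)).1).check = true := by
  decide +kernel
/-- E3 certificate `zL2d4DeficitAllU` component: `zL2d4DeficitAllU_blk10` (lane output, transcribed verbatim; see the module docstring). -/
theorem zL2d4DeficitAllU_blk10 : (GramCert.blockCert zL2d4DeficitAllU.nx zL2d4DeficitAllU.basis (zL2d4DeficitAllU.blocks.getD 10 (⟨[], 0, [], 0, []⟩, 0)).1).check = true := by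
  decide +kernel
/-- E3 certificate `zL2d4DeficitAllU` component: `zL2d4DeficitAllU_blk11` (lane output, transcribed verbatim; see the module docstring). -/
theorem zL2d4DeficitAllU_blk11 : (GramCert.blockCert zL2d4DeficitAllU.nx zL2d4DeficitAllU.basis (zL2d4DeficitAllU.blocks.getD 11 (⟨[], 0, [], 0, []⟩, 0)).1).check = true := by
  decide +kernel
/-- E3 certificate `zL2d4DeficitAllU` component: `zL2d4DeficitAllU_blk12` (lane output, transcribed verbatim; see the module docstring). -/
theorem zL2d4DeficitAllU_blk12 : (GramCert.blockCert zL2d4DeficitAllU.nx zL2d4DeficitAllU.basis (zL2d4DeficitAllU.blocks.getD 12 (⟨[], 0, [], 0, []⟩, 0)).1).check = true := by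
  decide +kernel
/-- E3 certificate `zL2d4DeficitAllU` component: `zL2d4DeficitAllU_blk13` (lane output, transcribed verbatim; see the module docstring). -/
theorem zL2d4DeficitAllU_blk13 : (GramCert.blockCert zL2d4DeficitAllU.nx zL2d4DeficitAllU.basis (zL2d4DeficitAllU.blocks.getD 13 (⟨[], 0, [], 0, []⟩, 0)).1).check = true := by
  decide +kernel
/-- E3 certificate `zL2d4DeficitAllU` component: `zL2d4DeficitAllU_blk14` (lane output, transcribed verbatim; see the module docstring). -/
theorem zL2d4DeficitAllU_blk14 : (GramCert.blockCert zL2d4DeficitAllU.nx zL2d4DeficitAllU.basis (zL2d4DeficitAllU.blocks.getD 14 (⟨[], 0, [], 0, []⟩, 0)).1).check = true := by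
  decide +kernel
end E3Z
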